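import Literature.NumberTheory.EllipticCurves.Kato2004.AdmissibleZetaClassRealisability
import Literature.NumberTheory.EllipticCurves.Kato2004.IwasawaH2FineSelmerDualComparison
import Literature.NumberTheory.EllipticCurves.Kato2004.FineSelmerDualTorsionOfEulerSystemBoundProofs
import Literature.NumberTheory.EllipticCurves.Kim2025.FineOneSidedDivisibility
import Literature.NumberTheory.EllipticCurves.KatoFineSelmerFiniteProofs
import HarnessLib

/-!
# Kato 2004 (Astérisque 295), Thm. 12.5 (4) — the height-one LENGTH INEQUALITY `ℓ_𝔭(𝐇²(T)) ≤ ℓ_𝔭(𝐇¹(T)/Z(f,T))`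
# for the lattice `T = T_pW` of an elliptic curve over `ℚ`, on the `Δ`-trivial component, in fine-Selmer form:
# `ℓ_𝔭(X₀(W/ℚ_∞)) ≤ ℓ_𝔭(𝐇¹_Γ(T_pW)/Λz₀)` for an ADMISSIBLE zeta class `z₀`, at EVERY height-one prime `𝔭` of `ℤ_p⟦T⟧`.
# ONE named fact + proved corollaries (the `𝐇²_Γ`-form on embedding packages; the `charIdeal` consumer shape).

Topic `NumberTheory/EllipticCurves`, sub-directory `Kato2004` (namespace = path). ONE `def … : Prop` (named fact, review-queued,
net debt +1), theorems otherwise; no instance, no notation, no `sorry`. Typed by planner `bsd-idea-9` (g40, ideator of route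
`ErratumRoadFive`, crux stmt-BirchSwinnertonDyer-19715, line `kato_Fframe` r5.2) on the pen's request (bsd-stepL g48,
2026-08-30T05:22:22Z: «typing F1′ as a Literature fact is ideator+critic work; when typed AND critic-passed the pen re-keys r5.3 with
S0 := S0 ∧ F1′»); it is the COMPANION of `AdmissibleZetaClassRealisability.lean`, whose fact
`exists_isAdmissibleZetaClass_of_imageContainsSL2` transcribes the INTEGRALITY half of Thm. 12.5 (4) («`Z(f,T) ⊂ 𝐇¹(T)`») and says
explicitly «the length inequality of (4) is NOT part of this fact» — this file is that other half. HONEST FRAMING: nothing about BSD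
is proved; EQUALITY of the lengths (Kato's Conj. 12.10 = the Main Conjecture) is NOT asserted; the fact is Kato's printed THEOREM
moved to the tree's vocabulary through the three printed identifications listed under READING, never stronger than print (SCOPE).

## PRINT (store copy `paper:doi-10-24033-ast-639`, PDF p. = print p. − 115; read 2026-08-30)

Thm. 12.5 (4) (p. 222): «Let `T` be a `Gal(ℚ̄/ℚ)`-stable `O_λ`-lattice of `V_{F_λ}(f)`, and let `Z(f, T)` be the `Λ`-submodule of
`𝐇¹(T) ⊗ ℚ` generated by `𝐳_γ^{(p)}` for all `γ ∈ T`. Assume `p ≠ 2`, and assume that the following (12.5.2) is satisfied.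
(12.5.2) There exists an `O_λ`-basis of `T` for which the image of `Gal(ℚ̄/ℚ(ζ_{p^∞})) → GL_{O_λ}(T) ≅ GL₂(O_λ)` contains
`SL₂(ℤ_p)`. Then, `Z(f, T) ⊂ 𝐇¹(T)`. Furthermore, `length_{Λ_𝔭}(𝐇²(T)_𝔭) ≤ length_{Λ_𝔭}(𝐇¹(T)_𝔭 / Z(f,T)_𝔭)` for any prime
ideal `𝔭` of `Λ` of height one unless `f` and `𝔭` satisfy (12.5.1) in (3).» Here `Λ = O_λ[[G_∞]]`, `G_∞ = Gal(ℚ(ζ_{p^∞})/ℚ) ≅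
Δ × Γ` (12.3, p. 221), `𝐇^q(T) = lim←_n H^q(ℤ[ζ_{p^n}, 1/p], T)` (12.2, p. 220; `j_*`-cohomology, 8.2 p. 181), and (12.5.1) (p. 222)
is: `f` is not potentially of good reduction at `p` and `𝔭` is the kernel of `Λ → F_λ` induced by a character of `G_∞` — by
Thm. 12.5 (3) exactly the height-one support of `𝐇²_loc(V)`, where «`𝐇²_loc(T) ≅ Hom(H⁰(ℚ_p(ζ_{p^∞}), Hom(T, ℚ/ℤ)), ℚ/ℤ)(−1)`»
(display after (12.2.3), p. 220).

## READING (the three identifications between print and the statement below; each is print or a tree definition)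

(R1) `T = T_pW`, `f = f_W` (modularity, as in every `Kato2004/` file), `O_λ = ℤ_p`; the `Δ`-TRIVIAL COMPONENT: `#Δ = p − 1` is prime
to `p`, so `Λ = ∏_χ Λ_χ` over the characters of `Δ`, a height-one prime of `Λ` lies in exactly one branch, and for a `Λ`-module `M`
and `𝔭` in the trivial branch `M_𝔭 = (e_𝟙 M)_𝔭`; `e_𝟙 𝐇^q(T_pW) = lim←_n H^q(ℤ_n[1/p], T_pW)` over the layers `ℚ_n` of the cyclotomic
`ℤ_p`-extension (restriction–corestriction, `p ∤ p − 1`) — the tree's `𝐇¹_Γ(T_pW)`, pinned as `I : IwasawaH1Data W p κ γ`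
(`Kato2004/IwasawaCohomology.lean`, READING (i) of `Kato2004/IwasawaH2Descent.lean`), `Λ_𝟙 = ℤ_p⟦T⟧ = IwasawaAlgebra p`, `T = γ − 1`.
(R2) `e_𝟙 Z(f_W, T_pW) = Λ_𝟙 · 𝐳_{γ_W}` (`γ ↦ 𝐳_γ` is `ℤ_p`-linear and the trivial component sees `γ⁺` only) and
`{z₀ : IsAdmissibleZetaClass W p κ hκ I z₀} = Λˣ · 𝐳_{γ_W} ∩ I.H` («HENCE, BY PRINT», module docstring of
`Kato2004/AdmissibleZetaClass.lean`), so for an admissible `z₀`: `Λz₀ = e_𝟙 Z(f_W,T_pW)` and `e_𝟙(𝐇¹(T)/Z(f,T)) = I.H ⧸ Λz₀`.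
(R3) `X₀(W/ℚ_∞)` (the constructed dual fine Selmer group `(W.fineSelmerDualData κ hγ).X`, Pontryagin dual of `Sel₀(W/ℚ_∞)[p^∞]`)
EMBEDS into `e_𝟙 𝐇²(T_pW) = 𝐇²_Γ(T_pW)`: the exact sequence `0 → X₀(ℚ_∞) → 𝐇²_Γ(T_pW) → 𝐇²_{Γ,loc}(T_pW) ≅ (W(ℚ_{p,∞})[p^∞])^∨`
((14.9.1) p. 239 «exact in the case `p ≠ 2`», in the limit (17.13.1) p. 279, the local term by the display after (12.2.3)) —
transcribed with page references in `Kato2004/IwasawaH2FineSelmerDualComparison.lean` (fact H2X) and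
`Kato2004/IwasawaH2FineSelmerDualLoc.lean` (H2X′); lengths do not increase along an injection.
HENCE, for `𝔭` of height one in `Λ_𝟙`: `ℓ_𝔭(X₀) ≤ ℓ_𝔭(𝐇²_Γ) = ℓ_𝔭(𝐇²(T_pW)) ≤ ℓ_𝔭(𝐇¹(T_pW)/Z) = ℓ_𝔭(I.H ⧸ Λz₀)` whenever `𝔭` is
not a (12.5.1)-prime; and the (12.5.1)-primes of the trivial branch are the height-one support of
`e_𝟙 𝐇²_loc(T_pW) = (W(ℚ_{p,∞})[p^∞])^∨`, which is EMPTY exactly when `W(ℚ_{p,∞})[p^∞]` is finite — the hypothesis `hfin` below,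
VERBATIM the hypothesis of H2X (there: it holds whenever `W` is potentially good at `p` — Imai, tree theorems
`finite_fixedPoints_kerSubgroup_inf_decomp_of_ordinary` / `…_of_padicValRat_j_nonneg` — and whenever `W` is multiplicative at `p`,
`p` odd (Tate curve: `μ_p ⊄ ℚ_{p,∞}`); it fails for `p` odd exactly at `p = 3`, `W/ℚ_3` the `ω`-twist of a Tate curve).

## SCOPE of the fact (exactly the printed hypotheses; where it says nothing)

* `p ≠ 2` and (12.5.2) = the tree's `ImageContainsSL2 W p` (`Kato2004/Condition1252.lean`), as in the realisability fact.
* `κ` CYCLOTOMIC with topological generator `γ` (the tower of 12.2; `Λ_𝟙 = ℤ_p⟦T⟧`); `W` a globally minimal model (only because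
  `IsAdmissibleZetaClass` is typed on one; the statement is isogeny-class free otherwise).
* `hfin`: `W(ℚ_{p,∞})[p^∞]` finite, in H2X's vocabulary (`ZpExtension.kerSubgroup`, `GreenbergSelmer.decomp v`, `v` the place at `p`).
* EVERY height-one prime `𝔭` of `ℤ_p⟦T⟧` — including `(p)` (the `μ`-part) and `(T)`; NO prime is excluded (the exclusion (12.5.1)
  is discharged by `hfin`, see READING). At a prime where `I.H ⧸ Λz₀` is not torsion the right side is `⊤` and the clause is empty.
* NOT CLAIMED: the reverse inequality / equality (Conj. 12.10, p. 224); anything at `p = 2`; anything when `hfin` fails; anything for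
  lattices other than `T_pW`, for non-trivial `Δ`-branches, or for modular forms of weight `> 2` (TODO(general form) in the
  realisability file).

## Consumers (Summits side; not imported here)

Route `ErratumRoadFive`, crux 19715, line `kato_Fframe`, stub S1Λ `stub_katoLambdaLogBoundTamagawa`: the helper
`Summit…Theorems.ErratumRoadFiveKatoFframeFineDescentRankOne.natCard_fineSelmer_invariants_dvd_index_of_lengthAt_le_of_rankOne_of_embedding_fact`
(p762750) takes the conclusion of this fact VERBATIM as its hypothesis `hlen` (with `Y := W.fineSelmerDualData κ hγ`) and H2X as
`hX`, and returns `#Sel₀(W/ℚ_∞)^Γ ∣ [H¹(ℤ[1/p],T_pW) : ℤ_p s₀]` in rank one. The pen keys S0 := S0 ∧ (this fact).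

References: [Kato2004Asterisque] Thm. 12.5 (3)–(4), (12.5.1)–(12.5.2) (p. 222), Conj. 12.10 (p. 224), 12.2–12.3 (pp. 220–221),
§13.14 (p. 234, proof of 12.5 (4)), (14.9.1) (p. 239), (17.13.1) (p. 279); [Kim2024BeilinsonKatoZetaGuide] §2.5.1, §4.3;
[GreenbergLNM1716] §3 (p. 86); tree files named above.
-/

noncomputable section


open scoped NumberField
open Field IsDedekindDomain WeierstrassCurve
open Literature.NumberTheory.GaloisRepresentations Literature.NumberTheory.EllipticCurves
open Literature.NumberTheory.EllipticCurves.IwasawaAlgebra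

namespace Literature.NumberTheory.EllipticCurves.Kato2004

/-! ## The named fact -/

/-- **Kato's Thm. 12.5 (4), height-one length inequality, for `T_pW` on the `Δ`-trivial component, in fine-Selmer form.**
For an elliptic curve `W/ℚ` (globally minimal model), an odd prime `p` with Kato's (12.5.2) (`ImageContainsSL2 W p`: the image
of `Gal(ℚ̄/ℚ(ζ_{p^∞}))` in `Aut(T_pW) ≅ GL₂(ℤ_p)` contains `SL₂(ℤ_p)`), the CYCLOTOMIC `ℤ_p`-extension `κ` with topological
generator `γ`, the place `v` of `ℚ` at `p`, under the hypothesis that `W(ℚ_{p,∞})[p^∞] = (W(ℚ̄)[p^∞])^{ker κ ⊓ D_v}` is finite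
(no (12.5.1)-prime in the trivial branch), for every pinned Iwasawa cohomology `I : IwasawaH1Data W p κ γ` (`𝐇¹_Γ(T_pW)`) and
every ADMISSIBLE zeta class `z₀ ∈ I.H` (`IsAdmissibleZetaClass`: a `Λˣ`-multiple of the `Ω_W`-normalised `𝐳_{γ_W}`; its `Λ`-span is
the `Δ`-trivial component of `Z(f_W, T_pW)`): at EVERY height-one prime `𝔭` of `Λ = ℤ_p⟦T⟧`,
`length_{Λ_𝔭} X₀(W/ℚ_∞)_𝔭 ≤ length_{Λ_𝔭} (𝐇¹_Γ(T_pW)/Λz₀)_𝔭`, `X₀(W/ℚ_∞) = (W.fineSelmerDualData κ hγ).X` the constructed dual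
fine Selmer group. PRINT: «`length_{Λ_𝔭}(𝐇²(T)_𝔭) ≤ length_{Λ_𝔭}(𝐇¹(T)_𝔭/Z(f,T)_𝔭)` for any prime ideal `𝔭` of `Λ` of height one
unless `f` and `𝔭` satisfy (12.5.1)», composed with `X₀ ↪ 𝐇²_Γ(T_pW)` ((14.9.1) in the limit) and the identifications (R1)–(R3) of
the module docstring. Named fact (review-queued); nothing asserted about equality (Conj. 12.10), about `p = 2`, or when
`W(ℚ_{p,∞})[p^∞]` is infinite.
[cite: Kato2004Asterisque, Thm. 12.5 (3)–(4) with (12.5.1)–(12.5.2) (p. 222); §13.14 (p. 234); (14.9.1) (p. 239); (17.13.1) (p. 279); 12.2 display after (12.2.3) (p. 220)]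
[cite: Kim2024BeilinsonKatoZetaGuide, §2.5.1 and §4.3] -/
def lengthAt_fineSelmerDual_le_of_isAdmissibleZetaClass : Prop :=
  ∀ (W : WeierstrassCurve ℚ) [W.IsElliptic] [W.IsGloballyMinimal] (p : ℕ) [Fact p.Prime]
    [ContinuousSMul ℤ_[p] (W.tateModule p)] (κ : ZpExtension ℚ p) (γ : absoluteGaloisGroup ℚ)
    (hκ : κ.IsCyclotomic) (hγ : κ.IsTopGenerator γ) (v : HeightOneSpectrum (𝓞 ℚ)),
    p ≠ 2 → ImageContainsSL2 W p → ((Rat.HeightOneSpectrum.primesEquiv v : Nat.Primes) : ℕ) = p →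
    Finite (FixedPoints.addSubgroup ↥(κ.kerSubgroup ⊓ GreenbergSelmer.decomp v) (W.geomPrimaryTorsion p)) →
    ∀ (I : IwasawaH1Data W p κ γ) (z₀ : I.H), IsAdmissibleZetaClass W p κ hκ I z₀ →
      ∀ 𝔭 : PrimeSpectrum (IwasawaAlgebra p), 𝔭.asIdeal.height = 1 →
        Module.lengthAt (IwasawaAlgebra p) (W.fineSelmerDualData κ hγ).X 𝔭 ≤
          Module.lengthAt (IwasawaAlgebra p) (I.H ⧸ Submodule.span (IwasawaAlgebra p) {z₀}) 𝔭

/-! ## Proved corollaries (the consumer shapes; no new fact) -/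

namespace lengthAt_fineSelmerDual_le_of_isAdmissibleZetaClass

variable {W : WeierstrassCurve ℚ} [W.IsElliptic] [W.IsGloballyMinimal] {p : ℕ} [Fact p.Prime]
  [ContinuousSMul ℤ_[p] (W.tateModule p)] {κ : ZpExtension ℚ p} {γ : absoluteGaloisGroup ℚ}

/-- **The `𝐇²_Γ`-form (print-verbatim shape) on a package RECEIVING `X₀`.** Under the fact: for any descent package
`J : IwasawaH2Data W p κ γ I` together with an injective `Λ`-linear `e : X₀(W/ℚ_∞) → J.H2` of finite cokernel (the shape delivered by
`exists_iwasawaH2Data_fineSelmerDual_embedding`), `ℓ_𝔭(J.H2) ≤ ℓ_𝔭(𝐇¹_Γ/Λz₀)` at every height-one `𝔭` — transport along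
`lengthAt_eq_of_injective_of_finite_quotient`. (Quantifying over ALL packages `J` instead would be false: `IwasawaH2Data` pins
`J.H2` only through `J.H2[T]`.) [cite: Kato2004Asterisque, Thm. 12.5 (4) (p. 222), (14.9.1) (p. 239), (14.14.1) (p. 243)] -/
theorem h2_form (h : lengthAt_fineSelmerDual_le_of_isAdmissibleZetaClass) (hκ : κ.IsCyclotomic)
    (hγ : κ.IsTopGenerator γ) (v : HeightOneSpectrum (𝓞 ℚ)) (hp : p ≠ 2) (hSL : ImageContainsSL2 W p)
    (hv : ((Rat.HeightOneSpectrum.primesEquiv v : Nat.Primes) : ℕ) = p)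
    (hfin : Finite (FixedPoints.addSubgroup ↥(κ.kerSubgroup ⊓ GreenbergSelmer.decomp v) (W.geomPrimaryTorsion p)))
    (I : IwasawaH1Data W p κ γ) (J : IwasawaH2Data W p κ γ I)
    (e : (W.fineSelmerDualData κ hγ).X →ₗ[IwasawaAlgebra p] J.H2) (he : Function.Injective e)
    (hcok : Finite (J.H2 ⧸ LinearMap.range e)) (z₀ : I.H) (hz : IsAdmissibleZetaClass W p κ hκ I z₀)
    (𝔭 : PrimeSpectrum (IwasawaAlgebra p)) (h𝔭 : 𝔭.asIdeal.height = 1) :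
    Module.lengthAt (IwasawaAlgebra p) J.H2 𝔭 ≤
      Module.lengthAt (IwasawaAlgebra p) (I.H ⧸ Submodule.span (IwasawaAlgebra p) {z₀}) 𝔭 := by
  rw [← lengthAt_eq_of_injective_of_finite_quotient e he hcok 𝔭 h𝔭.le]
  exact h W p κ γ hκ hγ v hp hSL hv hfin I z₀ hz 𝔭 h𝔭

/-- **The `charIdeal` consumer shape.** Under the fact, if `𝐇¹_Γ(T_pW)/Λz₀` is a torsion `Λ`-module (always the case for an
admissible `z₀`, which is `≠ 0` in the rank-one torsion-free `𝐇¹_Γ` — supplied by the consumer), then `X₀(W/ℚ_∞)` is torsion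
(finite length at `𝔭 = (T)`) and `char_Λ(𝐇¹_Γ/Λz₀) ⊆ char_Λ X₀(W/ℚ_∞)` (`Kim2025.charIdeal_le_charIdeal_of_lengthAt_le`) — the
hypothesis `hchar` of the fine descent engines. [cite: Kato2004Asterisque, Thm. 12.5 (4) (p. 222), §13.3 (p. 226)] -/
theorem charIdeal_le (h : lengthAt_fineSelmerDual_le_of_isAdmissibleZetaClass) (hκ : κ.IsCyclotomic)
    (hγ : κ.IsTopGenerator γ) (v : HeightOneSpectrum (𝓞 ℚ)) (hp : p ≠ 2) (hSL : ImageContainsSL2 W p)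
    (hv : ((Rat.HeightOneSpectrum.primesEquiv v : Nat.Primes) : ℕ) = p)
    (hfin : Finite (FixedPoints.addSubgroup ↥(κ.kerSubgroup ⊓ GreenbergSelmer.decomp v) (W.geomPrimaryTorsion p)))
    (I : IwasawaH1Data W p κ γ) (z₀ : I.H) (hz : IsAdmissibleZetaClass W p κ hκ I z₀)
    (hH : Module.IsTorsion (IwasawaAlgebra p) (I.H ⧸ Submodule.span (IwasawaAlgebra p) {z₀})) :
    Module.IsTorsion (IwasawaAlgebra p) (W.fineSelmerDualData κ hγ).X ∧
      Module.charIdeal (IwasawaAlgebra p) (I.H ⧸ Submodule.span (IwasawaAlgebra p) {z₀}) ≤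
        Module.charIdeal (IwasawaAlgebra p) (W.fineSelmerDualData κ hγ).X := by
  have hlen := h W p κ γ hκ hγ v hp hSL hv hfin I z₀ hz
  haveI : Module.Finite (IwasawaAlgebra p) I.H := IwasawaH1Data.module_finite_of_isCyclotomic hκ hγ I
  haveI : Module.Finite (IwasawaAlgebra p) (W.fineSelmerDualData κ hγ).X := FineSelmerDualData.module_finite W κ hγ _
  have hT : Module.lengthAt (IwasawaAlgebra p) (I.H ⧸ Submodule.span (IwasawaAlgebra p) {z₀}) (primeT p) ≠ ⊤ :=
    lengthAt_primeT_ne_top _ hH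
  have hX : Module.IsTorsion (IwasawaAlgebra p) (W.fineSelmerDualData κ hγ).X :=
    IwasawaAlgebra.isTorsion_of_lengthAt_primeT_ne_top _ (ne_top_of_le_ne_top hT (hlen (primeT p) (height_primeT p)))
  exact ⟨hX, Kim2025.charIdeal_le_charIdeal_of_lengthAt_le hH hX hlen⟩

end lengthAt_fineSelmerDual_le_of_isAdmissibleZetaClass

end Literature.NumberTheory.EllipticCurves.Kato2004

end
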